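import Summits.CriticalPhenomena.Ising3DConformalLimit.Theorems.LinkingParityCirclesSpinRatioMoebiusTwoPointConfigs
import HarnessLib

/-!
# Crux `LinkingParityCircles.SpinRatioMoebius` (stmt-CriticalPhenomena-4530), line `registered` —
# stub `stub_twoPointOfRatioLimit`: the pinned TWO-POINT scaling limit from the 4-point pairing-ratio limit

If the weight-free 4-point pairing ratio `Q^δ_2(x) = ⟨σσσσ⟩/(⟨σ_{x₀}σ_{x₂}⟩⟨σ_{x₁}σ_{x₃}⟩)` of the critical `ℤ³` Ising
model converges locally uniformly (as `δ → 0⁺`, on non-coincident configurations) to a continuous `q4`, then the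
PINNED two-point function `⟨σ_{[x/δ]}σ_{[y/δ]}⟩ / ⟨σ₀σ_{⌊1/δ⌋e₀}⟩` converges to `ψ(y − x)` locally uniformly off the
diagonal, where `ψ` is continuous and positive on `ℝ³ ∖ {0}` and homogeneous of some degree `−2Δ`.

Proof (files 1/3, 2/3 and this one): with `K_δ(u) = ⟨σ₀σ_{[u/δ]}⟩/⟨σ₀σ_{⌊1/δ⌋e₀}⟩` the exact identity
`K_δ² Q^δ_2(A) = Q^δ_2(B)` and `Q ≥ 1` (GKS) give `K_δ² → q4(B)/q4(A) =: Φᵢ` uniformly on compacts of the good set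
`Uᵢ = ℝ³ ∖ {0, ±eᵢ}`, hence `K_δ → √Φᵢ` (`tendstoUniformlyOn_of_sq`); so `ψ := lim K_δ` exists on `U₀ ∪ U₁ = ℝ³ ∖ {0}`,
is continuous and positive; the two-point functional at `(x, y)` IS `K_δ(y − x + δ·fract(x/δ))`
(`twoPoint_eq_kzero`), whence the locally uniform convergence by perturbed composition; and
`K_δ(cu) = K_{δ/c}(u) · ⟨σ₀σ_{⌊c/δ⌋e₀}⟩/⟨σ₀σ_{⌊1/δ⌋e₀}⟩` makes `ψ(cu)/ψ(u) =: Λ(c)` independent of `u`, `Λ`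
continuous and multiplicative, so `Λ(c) = c^{−2Δ}` (Cauchy's equation, `map_real_smul`).

References: S. Friedli, Y. Velenik (CUP 2017) Thm. 3.17, Exercise 3.14, Thm. 3.20; H. Duminil-Copin (2019)
Thm. 4.8 (two-point positivity).
-/

noncomputable section

namespace Summit.CriticalPhenomena.Ising3DConformalLimit.Cruxes.SpinRatioMoebius.Birth

open Literature.Probability.LatticeModels Filter Set Metric
open Summit.CriticalPhenomena.Ising3DConformalLimit.MoebiusLimitExistsNegative
open Summit.CriticalPhenomena.Ising3DConformalLimit.Cruxes.IsingEuclidUpgradeR4NonGaussian.FreeCovarianceDeltaDichotomy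
  (criticalCorr_two_pos')
open Summit.CriticalPhenomena.Ising3DConformalLimit.Theorems.MoebiusLimitOfTwoPointLaw.Negative
  (latticeApprox_smul tendsto_div_const_nhdsGT)
open scoped Topology

/-! ## §G From `K²` to `K`, the limit `ψ`, and the stub -/

/-- If `K ≥ 0`, `g ≥ m > 0` on `C` and `K² → g²` uniformly on `C`, then `K → g` uniformly on `C`
(`|g − K| (g + K) = |g² − K²|`). [folklore] -/
theorem tendstoUniformlyOn_of_sq {X ι : Type*} {p : Filter ι} {K : ι → X → ℝ} {g : X → ℝ} {C : Set X}
    (hK0 : ∀ᶠ i in p, ∀ y ∈ C, 0 ≤ K i y) {m : ℝ} (hm : 0 < m) (hg : ∀ y ∈ C, m ≤ g y)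
    (h : TendstoUniformlyOn (fun i y => K i y ^ 2) (fun y => g y ^ 2) p C) :
    TendstoUniformlyOn K g p C := by
  rw [Metric.tendstoUniformlyOn_iff] at h ⊢
  intro ε hε
  filter_upwards [h (ε * m) (by positivity), hK0] with i hi hi0 y hy
  have hgy := hg y hy
  have hKy := hi0 y hy
  have h1 := hi y hy
  rw [Real.dist_eq] at h1 ⊢
  have hsum : m ≤ g y + K i y := by linarith
  have hspos : 0 < g y + K i y := lt_of_lt_of_le hm hsum
  have hfac : |g y ^ 2 - K i y ^ 2| = |g y - K i y| * (g y + K i y) := by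
    rw [show g y ^ 2 - K i y ^ 2 = (g y - K i y) * (g y + K i y) by ring, abs_mul, abs_of_pos hspos]
  rw [hfac] at h1
  by_contra hcon
  push Not at hcon
  have h2 : ε * m ≤ |g y - K i y| * (g y + K i y) := mul_le_mul hcon hsum hm.le (abs_nonneg _)
  linarith

/-- A continuous multiplicative `Λ : (0, ∞) → (0, ∞)` is a power `c ↦ c ^ a` (Cauchy's functional equation
through `log ∘ Λ ∘ exp`, `map_real_smul`). [folklore] -/
theorem exists_rpow_of_mul_of_continuousOn {Λ : ℝ → ℝ} (hpos : ∀ c, 0 < c → 0 < Λ c)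
    (hcont : ContinuousOn Λ (Ioi 0)) (hmul : ∀ c c', 0 < c → 0 < c' → Λ (c * c') = Λ c * Λ c') :
    ∃ a : ℝ, ∀ c, 0 < c → Λ c = c ^ a := by
  -- the additive function `f = log ∘ Λ ∘ exp`
  set f : ℝ → ℝ := fun t => Real.log (Λ (Real.exp t)) with hf
  have hfadd : ∀ s t, f (s + t) = f s + f t := by
    intro s t
    simp only [hf, Real.exp_add]
    rw [hmul _ _ (Real.exp_pos s) (Real.exp_pos t),
      Real.log_mul (hpos _ (Real.exp_pos s)).ne' (hpos _ (Real.exp_pos t)).ne']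
  have hfcont : Continuous f := by
    have h1 : Continuous fun t => Λ (Real.exp t) :=
      hcont.comp_continuous Real.continuous_exp fun t => Real.exp_pos t
    exact h1.log fun t => (hpos _ (Real.exp_pos t)).ne'
  let φ : ℝ →+ ℝ :=
    { toFun := f
      map_zero' := by
        have h := hfadd 0 0
        rw [add_zero] at h
        linarith
      map_add' := hfadd }
  have hlin : ∀ t, f t = t * f 1 := by
    intro t
    have h := map_real_smul φ hfcont t 1
    simp only [smul_eq_mul, mul_one] at h
    exact h
  refine ⟨f 1, fun c hc => ?_⟩
  have h1 : Λ c = Real.exp (f (Real.log c)) := by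
    simp only [hf, Real.exp_log hc, Real.exp_log (hpos c hc)]
  rw [h1, hlin, Real.rpow_def_of_pos hc]

section TwoPoint


variable {q4 : (Fin (2 + 2) → EuclideanSpace ℝ (Fin 3)) → ℝ}

/-- `(fun (δ : ℝ) (u : EuclideanSpace ℝ (Fin 3)) => criticalCorr 3 2 ![0, latticeApprox δ u] / criticalCorr 3 2 ![(0 : Site 3), Pi.single (0 : Fin 3) (⌊1 / δ⌋ : ℤ)]) ≥ 0`. [folklore] -/
theorem kzero_nonneg (δ : ℝ) (u : EuclideanSpace ℝ (Fin 3)) : 0 ≤ (fun (δ : ℝ) (u : EuclideanSpace ℝ (Fin 3)) => criticalCorr 3 2 ![0, latticeApprox δ u] / criticalCorr 3 2 ![(0 : Site 3), Pi.single (0 : Fin 3) (⌊1 / δ⌋ : ℤ)]) δ u :=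
  div_nonneg (criticalCorr_two_pos' _ _).le (criticalCorr_two_pos' _ _).le

/-- `(fun (q4 : (Fin (2 + 2) → EuclideanSpace ℝ (Fin 3)) → ℝ) (i : Fin 3) (u : EuclideanSpace ℝ (Fin 3)) => q4 ![0, u, (fun (i : Fin 3) => siteVec (Pi.single i (1:ℤ) : Site 3)) i, u + (fun (i : Fin 3) => siteVec (Pi.single i (1:ℤ) : Site 3)) i] / q4 ![0, (fun (i : Fin 3) => siteVec (Pi.single i (1:ℤ) : Site 3)) i, u, u + (fun (i : Fin 3) => siteVec (Pi.single i (1:ℤ) : Site 3)) i])ᵢ` is continuous and `> 0` on `Uᵢ`. [folklore] -/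
theorem continuousOn_phi (hcont : ContinuousOn q4 (NonCoincident 3 (2 + 2)))
    (h4 : TendstoLocallyUniformlyOn (fun (δ : ℝ) (x : Fin (2 + 2) → EuclideanSpace ℝ (Fin 3)) => criticalCorr 3 (2 + 2) (fun j => latticeApprox δ (x j)) / ∏ j : Fin 2, criticalCorr 3 2 ![latticeApprox δ (x (Fin.castAdd 2 j)), latticeApprox δ (x (Fin.natAdd 2 j))]) q4 (𝓝[>] (0:ℝ)) (NonCoincident 3 (2 + 2))) (i : Fin 3) :
    ContinuousOn ((fun (q4 : (Fin (2 + 2) → EuclideanSpace ℝ (Fin 3)) → ℝ) (i : Fin 3) (u : EuclideanSpace ℝ (Fin 3)) => q4 ![0, u, (fun (i : Fin 3) => siteVec (Pi.single i (1:ℤ) : Site 3)) i, u + (fun (i : Fin 3) => siteVec (Pi.single i (1:ℤ) : Site 3)) i] / q4 ![0, (fun (i : Fin 3) => siteVec (Pi.single i (1:ℤ) : Site 3)) i, u, u + (fun (i : Fin 3) => siteVec (Pi.single i (1:ℤ) : Site 3)) i]) q4 i) {u : EuclideanSpace ℝ (Fin 3) | (![0, (fun (i : Fin 3) => siteVec (Pi.single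 i (1:ℤ) : Site 3)) i, u, u + (fun (i : Fin 3) => siteVec (Pi.single i (1:ℤ) : Site 3)) i] : Fin (2 + 2) → EuclideanSpace ℝ (Fin 3)) ∈ NonCoincident 3 (2 + 2)} := by
  have hBmem : ∀ u ∈ {u : EuclideanSpace ℝ (Fin 3) | (![0, (fun (i : Fin 3) => siteVec (Pi.single i (1:ℤ) : Site 3)) i, u, u + (fun (i : Fin 3) => siteVec (Pi.single i (1:ℤ) : Site 3)) i] : Fin (2 + 2) → EuclideanSpace ℝ (Fin 3)) ∈ NonCoincident 3 (2 + 2)}, (![0, u, (fun (i : Fin 3) => siteVec (Pi.single i (1:ℤ) : Site 3)) i, u + (fun (i : Fin 3) => siteVec (Pi.single i (1:ℤ) : Site 3)) i] : Fin (2 + 2) → EuclideanSpace ℝ (Fin 3)) ∈ NonCoincident 3 (2 + 2) := by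
    intro u hu
    obtain ⟨h0, h1, h2⟩ := of_configA_mem_nonCoincident hu
    exact configB_mem_nonCoincident (siteVec_single_ne_zero i) h0 h1 h2
  refine ContinuousOn.div (hcont.comp (continuous_configB _).continuousOn fun u hu => hBmem u hu)
    (hcont.comp (continuous_configA _).continuousOn fun u hu => hu) fun u hu => ?_
  exact (lt_of_lt_of_le one_pos (one_le_ratioLimit_two h4 hu)).ne'

/-- `(fun (q4 : (Fin (2 + 2) → EuclideanSpace ℝ (Fin 3)) → ℝ) (i : Fin 3) (u : EuclideanSpace ℝ (Fin 3)) => q4 ![0, u, (fun (i : Fin 3) => siteVec (Pi.single i (1:ℤ) : Site 3)) i, u + (fun (i : Fin 3) => siteVec (Pi.single i (1:ℤ) : Site 3)) i] / q4 ![0, (fun (i : Fin 3) => siteVec (Pi.single i (1:ℤ) : Site 3)) i, u, u + (fun (i : Fin 3) => siteVec (Pi.single i (1:ℤ) : Site 3)) i])ᵢ > 0` on `Uᵢ` (both ratio limits are `≥ 1`). [folklore] -/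
theorem phi_pos (h4 : TendstoLocallyUniformlyOn (fun (δ : ℝ) (x : Fin (2 + 2) → EuclideanSpace ℝ (Fin 3)) => criticalCorr 3 (2 + 2) (fun j => latticeApprox δ (x j)) / ∏ j : Fin 2, criticalCorr 3 2 ![latticeApprox δ (x (Fin.castAdd 2 j)), latticeApprox δ (x (Fin.natAdd 2 j))]) q4 (𝓝[>] (0:ℝ)) (NonCoincident 3 (2 + 2))) (i : Fin 3)
    {u : EuclideanSpace ℝ (Fin 3)} (hu : u ∈ {u : EuclideanSpace ℝ (Fin 3) | (![0, (fun (i : Fin 3) => siteVec (Pi.single i (1:ℤ) : Site 3)) i, u, u + (fun (i : Fin 3) => siteVec (Pi.single i (1:ℤ) : Site 3)) i] : Fin (2 + 2) → EuclideanSpace ℝ (Fin 3)) ∈ NonCoincident 3 (2 + 2)}) : 0 < (fun (q4 : (Fin (2 + 2) → EuclideanSpace ℝ (Fin 3)) → ℝ) (i : Fin 3) (u : EuclideanSpace ℝ (Fin 3)) => q4 ![0, u, (fun (i : Fin 3) => siteVec (Pi.single i (1:ℤ) : Site 3)) i, u + (fun (i : Fin 3) => siteVec (Pi.single i (1:ℤ)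 : Site 3)) i] / q4 ![0, (fun (i : Fin 3) => siteVec (Pi.single i (1:ℤ) : Site 3)) i, u, u + (fun (i : Fin 3) => siteVec (Pi.single i (1:ℤ) : Site 3)) i]) q4 i u := by
  obtain ⟨h0, h1, h2⟩ := of_configA_mem_nonCoincident hu
  have hB := configB_mem_nonCoincident (siteVec_single_ne_zero i) h0 h1 h2
  exact div_pos (lt_of_lt_of_le one_pos (one_le_ratioLimit_two h4 hB))
    (lt_of_lt_of_le one_pos (one_le_ratioLimit_two h4 hu))

/-- `(fun (δ : ℝ) (u : EuclideanSpace ℝ (Fin 3)) => criticalCorr 3 2 ![0, latticeApprox δ u] / criticalCorr 3 2 ![(0 : Site 3), Pi.single (0 : Fin 3) (⌊1 / δ⌋ : ℤ)]) → √(fun (q4 : (Fin (2 + 2) → EuclideanSpace ℝ (Fin 3)) → ℝ) (i : Fin 3) (u : EuclideanSpace ℝ (Fin 3)) => q4 ![0, u, (fun (i : Fin 3) => siteVec (Pi.single i (1:ℤ) : Site 3)) i, u + (fun (i : Fin 3) => siteVec (Pi.single i (1:ℤ) : Site 3)) i] / q4 ![0, (fun (i : Fin 3) => siteVec (Pi.single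 i (1:ℤ) : Site 3)) i, u, u + (fun (i : Fin 3) => siteVec (Pi.single i (1:ℤ) : Site 3)) i])ᵢ` locally uniformly on `Uᵢ`. [folklore] -/
theorem tendsto_kzero_sqrt_phi (h4 : TendstoLocallyUniformlyOn (fun (δ : ℝ) (x : Fin (2 + 2) → EuclideanSpace ℝ (Fin 3)) => criticalCorr 3 (2 + 2) (fun j => latticeApprox δ (x j)) / ∏ j : Fin 2, criticalCorr 3 2 ![latticeApprox δ (x (Fin.castAdd 2 j)), latticeApprox δ (x (Fin.natAdd 2 j))]) q4 (𝓝[>] (0:ℝ)) (NonCoincident 3 (2 + 2)))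
    (hcont : ContinuousOn q4 (NonCoincident 3 (2 + 2))) (i : Fin 3) :
    TendstoLocallyUniformlyOn (fun (δ : ℝ) (u : EuclideanSpace ℝ (Fin 3)) => criticalCorr 3 2 ![0, latticeApprox δ u] / criticalCorr 3 2 ![(0 : Site 3), Pi.single (0 : Fin 3) (⌊1 / δ⌋ : ℤ)]) (fun u => Real.sqrt ((fun (q4 : (Fin (2 + 2) → EuclideanSpace ℝ (Fin 3)) → ℝ) (i : Fin 3) (u : EuclideanSpace ℝ (Fin 3)) => q4 ![0, u, (fun (i : Fin 3) => siteVec (Pi.single i (1:ℤ) : Site 3)) i, u + (fun (i : Fin 3) => siteVec (Pi.single i (1:ℤ) : Site 3)) i] / q4 ![0, (fun (i : Fin 3) => siteVec (Pi.single i (1:ℤ) : Site 3)) i, u, u + (fun (i : Fin 3) => siteVec (Pi.single i (1:ℤ) : Site 3)) i]) q4 i u)) (𝓝[>] (0:ℝ)) {u : EuclideanSpace ℝ (Fin 3) | (![0, (fun (i : Fin 3) => siteVec (Pi.single i (1:ℤ) : Site 3)) i, u, u + (fun (i : Fin 3) => siteVec (Pi.single i (1:ℤ) : Site 3)) i] :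 Fin (2 + 2) → EuclideanSpace ℝ (Fin 3)) ∈ NonCoincident 3 (2 + 2)} := by
  rw [tendstoLocallyUniformlyOn_iff_forall_isCompact (isOpen_goodSet i)]
  intro C hCU hC
  rcases C.eq_empty_or_nonempty with rfl | hCne
  · exact tendstoUniformlyOn_empty
  -- positive minimum of `√(fun (q4 : (Fin (2 + 2) → EuclideanSpace ℝ (Fin 3)) → ℝ) (i : Fin 3) (u : EuclideanSpace ℝ (Fin 3)) => q4 ![0, u, (fun (i : Fin 3) => siteVec (Pi.single i (1:ℤ) : Site 3)) i, u + (fun (i : Fin 3) => siteVec (Pi.single i (1:ℤ) : Site 3)) i] / q4 ![0, (fun (i : Fin 3) => siteVec (Pi.single i (1:ℤ) : Site 3)) i, u, u + (fun (i : Fin 3) => siteVec (Pi.single i (1:ℤ) : Site 3)) i])` on `C`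
  have hgc : ContinuousOn (fun u => Real.sqrt ((fun (q4 : (Fin (2 + 2) → EuclideanSpace ℝ (Fin 3)) → ℝ) (i : Fin 3) (u : EuclideanSpace ℝ (Fin 3)) => q4 ![0, u, (fun (i : Fin 3) => siteVec (Pi.single i (1:ℤ) : Site 3)) i, u + (fun (i : Fin 3) => siteVec (Pi.single i (1:ℤ) : Site 3)) i] / q4 ![0, (fun (i : Fin 3) => siteVec (Pi.single i (1:ℤ) : Site 3)) i, u, u + (fun (i : Fin 3) => siteVec (Pi.single i (1:ℤ) : Site 3)) i]) q4 i u)) C :=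
    (Real.continuous_sqrt.comp_continuousOn (continuousOn_phi hcont h4 i)).mono hCU
  obtain ⟨y₀, hy₀, hmin⟩ := hC.exists_isMinOn hCne hgc
  have hm : 0 < Real.sqrt ((fun (q4 : (Fin (2 + 2) → EuclideanSpace ℝ (Fin 3)) → ℝ) (i : Fin 3) (u : EuclideanSpace ℝ (Fin 3)) => q4 ![0, u, (fun (i : Fin 3) => siteVec (Pi.single i (1:ℤ) : Site 3)) i, u + (fun (i : Fin 3) => siteVec (Pi.single i (1:ℤ) : Site 3)) i] / q4 ![0, (fun (i : Fin 3) => siteVec (Pi.single i (1:ℤ) : Site 3)) i, u, u + (fun (i : Fin 3) => siteVec (Pi.single i (1:ℤ) : Site 3)) i]) q4 i y₀) := Real.sqrt_pos.2 (phi_pos h4 i (hCU hy₀))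
  refine tendstoUniformlyOn_of_sq (Filter.Eventually.of_forall fun δ y _ => kzero_nonneg δ y) hm
    (fun y hy => hmin hy) ?_
  refine (tendstoUniformlyOn_ksq h4 hcont i hC hCU).congr_right fun y hy => ?_
  exact (Real.sq_sqrt (phi_pos h4 i (hCU hy)).le).symm

/-- The limit `ψ(u) = lim_{δ→0⁺} (fun (δ : ℝ) (u : EuclideanSpace ℝ (Fin 3)) => criticalCorr 3 2 ![0, latticeApprox δ u] / criticalCorr 3 2 ![(0 : Site 3), Pi.single (0 : Fin 3) (⌊1 / δ⌋ : ℤ)])(δ, u)` equals `√(fun (q4 : (Fin (2 + 2) → EuclideanSpace ℝ (Fin 3)) → ℝ) (i : Fin 3) (u : EuclideanSpace ℝ (Fin 3)) => q4 ![0, u, (fun (i : Fin 3) => siteVec (Pi.single i (1:ℤ) : Site 3)) i, u + (fun (i : Fin 3) => siteVec (Pi.single i (1:ℤ) : Site 3)) i] / q4 ![0, (fun (i : Fin 3) => siteVec (Pi.single i (1:ℤ) : Site 3)) i, u, u + (fun (i : Fin 3) => siteVec (Pi.single i (1:ℤ) : Site 3)) i])ᵢ(u)` on `Uᵢ`. [folklore]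 -/
theorem psi_eq (h4 : TendstoLocallyUniformlyOn (fun (δ : ℝ) (x : Fin (2 + 2) → EuclideanSpace ℝ (Fin 3)) => criticalCorr 3 (2 + 2) (fun j => latticeApprox δ (x j)) / ∏ j : Fin 2, criticalCorr 3 2 ![latticeApprox δ (x (Fin.castAdd 2 j)), latticeApprox δ (x (Fin.natAdd 2 j))]) q4 (𝓝[>] (0:ℝ)) (NonCoincident 3 (2 + 2)))
    (hcont : ContinuousOn q4 (NonCoincident 3 (2 + 2))) (i : Fin 3) {u : EuclideanSpace ℝ (Fin 3)} (hu : u ∈ {u : EuclideanSpace ℝ (Fin 3) | (![0, (fun (i : Fin 3) => siteVec (Pi.single i (1:ℤ) : Site 3)) i, u, u + (fun (i : Fin 3) => siteVec (Pi.single i (1:ℤ) : Site 3)) i] : Fin (2 + 2) → EuclideanSpace ℝ (Fin 3)) ∈ NonCoincident 3 (2 + 2)}) :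
    limUnder (𝓝[>] (0:ℝ)) (fun δ => (fun (δ : ℝ) (u : EuclideanSpace ℝ (Fin 3)) => criticalCorr 3 2 ![0, latticeApprox δ u] / criticalCorr 3 2 ![(0 : Site 3), Pi.single (0 : Fin 3) (⌊1 / δ⌋ : ℤ)]) δ u) = Real.sqrt ((fun (q4 : (Fin (2 + 2) → EuclideanSpace ℝ (Fin 3)) → ℝ) (i : Fin 3) (u : EuclideanSpace ℝ (Fin 3)) => q4 ![0, u, (fun (i : Fin 3) => siteVec (Pi.single i (1:ℤ) : Site 3)) i, u + (fun (i : Fin 3) => siteVec (Pi.single i (1:ℤ) : Site 3)) i] / q4 ![0, (fun (i : Fin 3) => siteVec (Pi.single i (1:ℤ) : Site 3)) i, u, u + (fun (i : Fin 3) => siteVec (Pi.single i (1:ℤ) : Site 3)) i]) q4 i u) :=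
  ((tendsto_kzero_sqrt_phi h4 hcont i).tendsto_at hu).limUnder_eq

/-- `(fun (δ : ℝ) (u : EuclideanSpace ℝ (Fin 3)) => criticalCorr 3 2 ![0, latticeApprox δ u] / criticalCorr 3 2 ![(0 : Site 3), Pi.single (0 : Fin 3) (⌊1 / δ⌋ : ℤ)]) → ψ` locally uniformly on `Uᵢ`. [folklore] -/
theorem tendsto_kzero_psi_good (h4 : TendstoLocallyUniformlyOn (fun (δ : ℝ) (x : Fin (2 + 2) → EuclideanSpace ℝ (Fin 3)) => criticalCorr 3 (2 + 2) (fun j => latticeApprox δ (x j)) / ∏ j : Fin 2, criticalCorr 3 2 ![latticeApprox δ (x (Fin.castAdd 2 j)), latticeApprox δ (x (Fin.natAdd 2 j))]) q4 (𝓝[>] (0:ℝ)) (NonCoincident 3 (2 + 2)))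
    (hcont : ContinuousOn q4 (NonCoincident 3 (2 + 2))) (i : Fin 3) :
    TendstoLocallyUniformlyOn (fun (δ : ℝ) (u : EuclideanSpace ℝ (Fin 3)) => criticalCorr 3 2 ![0, latticeApprox δ u] / criticalCorr 3 2 ![(0 : Site 3), Pi.single (0 : Fin 3) (⌊1 / δ⌋ : ℤ)]) (fun u => limUnder (𝓝[>] (0:ℝ)) (fun δ => (fun (δ : ℝ) (u : EuclideanSpace ℝ (Fin 3)) => criticalCorr 3 2 ![0, latticeApprox δ u] / criticalCorr 3 2 ![(0 : Site 3), Pi.single (0 : Fin 3) (⌊1 / δ⌋ : ℤ)]) δ u)) (𝓝[>] (0:ℝ)) {u : EuclideanSpace ℝ (Fin 3) | (![0, (fun (i : Fin 3) => siteVec (Pi.single i (1:ℤ) : Site 3)) i, u, u + (fun (i : Fin 3) => siteVec (Pi.single i (1:ℤ) : Site 3)) i] : Fin (2 + 2) → EuclideanSpace ℝ (Fin 3)) ∈ NonCoincident 3 (2 + 2)} :=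
  (tendsto_kzero_sqrt_phi h4 hcont i).congr_right fun _ hu => (psi_eq h4 hcont i hu).symm

/-- `eᵢ ≠ ± eⱼ` for `i ≠ j`. [folklore] -/
theorem siteVec_single_ne {i j : Fin 3} (hij : i ≠ j) : ((fun (i : Fin 3) => siteVec (Pi.single i (1:ℤ) : Site 3)) i) ≠ ((fun (i : Fin 3) => siteVec (Pi.single i (1:ℤ) : Site 3)) j) ∧ ((fun (i : Fin 3) => siteVec (Pi.single i (1:ℤ) : Site 3)) i) ≠ -((fun (i : Fin 3) => siteVec (Pi.single i (1:ℤ) : Site 3)) j) := by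
  constructor
  · intro h
    have := congr_arg (fun v : EuclideanSpace ℝ (Fin 3) => v i) h
    simp [siteVec_apply, Pi.single_eq_of_ne hij] at this
  · intro h
    have := congr_arg (fun v : EuclideanSpace ℝ (Fin 3) => v i) h
    simp [siteVec_apply, Pi.single_eq_of_ne hij] at this

/-- The two good sets `U₀`, `U₁` cover `ℝ³ ∖ {0}`. [folklore] -/
theorem compl_zero_subset_goodSets : ({0}ᶜ : Set (EuclideanSpace ℝ (Fin 3))) ⊆ {u : EuclideanSpace ℝ (Fin 3) | (![0, (fun (i : Fin 3) => siteVec (Pi.single i (1:ℤ) : Site 3)) 0, u, u + (fun (i : Fin 3) => siteVec (Pi.single i (1:ℤ) : Site 3)) 0] : Fin (2 + 2) → EuclideanSpace ℝ (Fin 3)) ∈ NonCoincident 3 (2 + 2)} ∪ {u : EuclideanSpace ℝ (Fin 3) | (![0, (fun (i : Fin 3) => siteVec (Pi.single i (1:ℤ) : Site 3)) 1, u, u + (fun (i : Fin 3) => siteVec (Pi.single i (1:ℤ) : Site 3)) 1] : Fin (2 + 2) → EuclideanSpace ℝ (Fin 3)) ∈ NonCoincident 3 (2 + 2)} := by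
  intro u hu
  rw [mem_compl_iff, mem_singleton_iff] at hu
  by_cases h : u = (fun (i : Fin 3) => siteVec (Pi.single i (1:ℤ) : Site 3)) 0 ∨ u = -((fun (i : Fin 3) => siteVec (Pi.single i (1:ℤ) : Site 3)) 0)
  · right
    obtain ⟨hne, hne'⟩ := siteVec_single_ne (show (0 : Fin 3) ≠ 1 by decide)
    rcases h with rfl | rfl
    · exact configA_mem_nonCoincident (siteVec_single_ne_zero 1) hu hne hne'
    · refine configA_mem_nonCoincident (siteVec_single_ne_zero 1) hu ?_ ?_
      · intro h'; exact hne' (by rw [← h', neg_neg])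
      · intro h'; exact hne (neg_injective h')
  · push Not at h
    left
    exact configA_mem_nonCoincident (siteVec_single_ne_zero 0) hu h.1 h.2

/-- `(fun (δ : ℝ) (u : EuclideanSpace ℝ (Fin 3)) => criticalCorr 3 2 ![0, latticeApprox δ u] / criticalCorr 3 2 ![(0 : Site 3), Pi.single (0 : Fin 3) (⌊1 / δ⌋ : ℤ)]) → ψ` locally uniformly on `ℝ³ ∖ {0}`. [folklore] -/
theorem tendsto_kzero_psi (h4 : TendstoLocallyUniformlyOn (fun (δ : ℝ) (x : Fin (2 + 2) → EuclideanSpace ℝ (Fin 3)) => criticalCorr 3 (2 + 2) (fun j => latticeApprox δ (x j)) / ∏ j : Fin 2, criticalCorr 3 2 ![latticeApprox δ (x (Fin.castAdd 2 j)), latticeApprox δ (x (Fin.natAdd 2 j))]) q4 (𝓝[>] (0:ℝ)) (NonCoincident 3 (2 + 2)))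
    (hcont : ContinuousOn q4 (NonCoincident 3 (2 + 2))) :
    TendstoLocallyUniformlyOn (fun (δ : ℝ) (u : EuclideanSpace ℝ (Fin 3)) => criticalCorr 3 2 ![0, latticeApprox δ u] / criticalCorr 3 2 ![(0 : Site 3), Pi.single (0 : Fin 3) (⌊1 / δ⌋ : ℤ)]) (fun u => limUnder (𝓝[>] (0:ℝ)) (fun δ => (fun (δ : ℝ) (u : EuclideanSpace ℝ (Fin 3)) => criticalCorr 3 2 ![0, latticeApprox δ u] / criticalCorr 3 2 ![(0 : Site 3), Pi.single (0 : Fin 3) (⌊1 / δ⌋ : ℤ)]) δ u)) (𝓝[>] (0:ℝ))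
      ({0}ᶜ : Set (EuclideanSpace ℝ (Fin 3))) :=
  (((tendsto_kzero_psi_good h4 hcont 0).union (isOpen_goodSet 0) (isOpen_goodSet 1)
    (tendsto_kzero_psi_good h4 hcont 1))).mono compl_zero_subset_goodSets

/-- `ψ` is continuous on `ℝ³ ∖ {0}`. [folklore] -/
theorem continuousOn_psi (h4 : TendstoLocallyUniformlyOn (fun (δ : ℝ) (x : Fin (2 + 2) → EuclideanSpace ℝ (Fin 3)) => criticalCorr 3 (2 + 2) (fun j => latticeApprox δ (x j)) / ∏ j : Fin 2, criticalCorr 3 2 ![latticeApprox δ (x (Fin.castAdd 2 j)), latticeApprox δ (x (Fin.natAdd 2 j))]) q4 (𝓝[>] (0:ℝ)) (NonCoincident 3 (2 + 2)))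
    (hcont : ContinuousOn q4 (NonCoincident 3 (2 + 2))) :
    ContinuousOn (fun u => limUnder (𝓝[>] (0:ℝ)) (fun δ => (fun (δ : ℝ) (u : EuclideanSpace ℝ (Fin 3)) => criticalCorr 3 2 ![0, latticeApprox δ u] / criticalCorr 3 2 ![(0 : Site 3), Pi.single (0 : Fin 3) (⌊1 / δ⌋ : ℤ)]) δ u)) ({0}ᶜ : Set (EuclideanSpace ℝ (Fin 3))) := by
  intro u hu
  have key : ∀ i : Fin 3, u ∈ {u : EuclideanSpace ℝ (Fin 3) | (![0, (fun (i : Fin 3) => siteVec (Pi.single i (1:ℤ) : Site 3)) i, u, u + (fun (i : Fin 3) => siteVec (Pi.single i (1:ℤ) : Site 3)) i] : Fin (2 + 2) → EuclideanSpace ℝ (Fin 3)) ∈ NonCoincident 3 (2 + 2)} →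
      ContinuousWithinAt (fun u => limUnder (𝓝[>] (0:ℝ)) (fun δ => (fun (δ : ℝ) (u : EuclideanSpace ℝ (Fin 3)) => criticalCorr 3 2 ![0, latticeApprox δ u] / criticalCorr 3 2 ![(0 : Site 3), Pi.single (0 : Fin 3) (⌊1 / δ⌋ : ℤ)]) δ u)) ({0}ᶜ : Set (EuclideanSpace ℝ (Fin 3))) u := by
    intro i hui
    have hci : ContinuousAt (fun u => Real.sqrt ((fun (q4 : (Fin (2 + 2) → EuclideanSpace ℝ (Fin 3)) → ℝ) (i : Fin 3) (u : EuclideanSpace ℝ (Fin 3)) => q4 ![0, u, (fun (i : Fin 3) => siteVec (Pi.single i (1:ℤ) : Site 3)) i, u + (fun (i : Fin 3) => siteVec (Pi.single i (1:ℤ) : Site 3)) i] / q4 ![0, (fun (i : Fin 3) => siteVec (Pi.single i (1:ℤ) : Site 3)) i, u, u + (fun (i : Fin 3) => siteVec (Pi.single i (1:ℤ) : Site 3)) i]) q4 i u)) u :=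
      ((Real.continuous_sqrt.comp_continuousOn (continuousOn_phi hcont h4 i)).continuousAt
        ((isOpen_goodSet i).mem_nhds hui))
    have heq : (fun u => limUnder (𝓝[>] (0:ℝ)) (fun δ => (fun (δ : ℝ) (u : EuclideanSpace ℝ (Fin 3)) => criticalCorr 3 2 ![0, latticeApprox δ u] / criticalCorr 3 2 ![(0 : Site 3), Pi.single (0 : Fin 3) (⌊1 / δ⌋ : ℤ)]) δ u)) =ᶠ[𝓝 u] fun u => Real.sqrt ((fun (q4 : (Fin (2 + 2) → EuclideanSpace ℝ (Fin 3)) → ℝ) (i : Fin 3) (u : EuclideanSpace ℝ (Fin 3)) => q4 ![0, u, (fun (i : Fin 3) => siteVec (Pi.single i (1:ℤ) : Site 3)) i, u + (fun (i : Fin 3) => siteVec (Pi.single i (1:ℤ) : Site 3)) i] / q4 ![0, (fun (i : Fin 3) => siteVec (Pi.single i (1:ℤ) : Site 3)) i, u, u + (fun (i : Fin 3) => siteVec (Pi.single i (1:ℤ) : Site 3)) i]) q4 i u) := by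
      filter_upwards [(isOpen_goodSet i).mem_nhds hui] with v hv
      exact psi_eq h4 hcont i hv
    exact (hci.congr_of_eventuallyEq heq).continuousWithinAt
  rcases compl_zero_subset_goodSets hu with h | h
  · exact key 0 h
  · exact key 1 h

/-- `ψ > 0` on `ℝ³ ∖ {0}`. [folklore] -/
theorem psi_pos (h4 : TendstoLocallyUniformlyOn (fun (δ : ℝ) (x : Fin (2 + 2) → EuclideanSpace ℝ (Fin 3)) => criticalCorr 3 (2 + 2) (fun j => latticeApprox δ (x j)) / ∏ j : Fin 2, criticalCorr 3 2 ![latticeApprox δ (x (Fin.castAdd 2 j)), latticeApprox δ (x (Fin.natAdd 2 j))]) q4 (𝓝[>] (0:ℝ)) (NonCoincident 3 (2 + 2)))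
    (hcont : ContinuousOn q4 (NonCoincident 3 (2 + 2))) {u : EuclideanSpace ℝ (Fin 3)} (hu : u ≠ 0) :
    0 < limUnder (𝓝[>] (0:ℝ)) (fun δ => (fun (δ : ℝ) (u : EuclideanSpace ℝ (Fin 3)) => criticalCorr 3 2 ![0, latticeApprox δ u] / criticalCorr 3 2 ![(0 : Site 3), Pi.single (0 : Fin 3) (⌊1 / δ⌋ : ℤ)]) δ u) := by
  rcases compl_zero_subset_goodSets (show u ∈ ({0}ᶜ : Set (EuclideanSpace ℝ (Fin 3))) from hu) with h | h
  · rw [psi_eq h4 hcont 0 h]; exact Real.sqrt_pos.2 (phi_pos h4 0 h)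
  · rw [psi_eq h4 hcont 1 h]; exact Real.sqrt_pos.2 (phi_pos h4 1 h)

/-! ### The two-point functional through `(fun (δ : ℝ) (u : EuclideanSpace ℝ (Fin 3)) => criticalCorr 3 2 ![0, latticeApprox δ u] / criticalCorr 3 2 ![(0 : Site 3), Pi.single (0 : Fin 3) (⌊1 / δ⌋ : ℤ)])` -/

/-- `⟨σ_{[x₀/δ]}σ_{[x₁/δ]}⟩ / ⟨σ₀σ_{⌊1/δ⌋e₀}⟩ = (fun (δ : ℝ) (u : EuclideanSpace ℝ (Fin 3)) => criticalCorr 3 2 ![0, latticeApprox δ u] / criticalCorr 3 2 ![(0 : Site 3), Pi.single (0 : Fin 3) (⌊1 / δ⌋ : ℤ)])(δ, x₁ − x₀ + δ·fract(x₀/δ))` (exactly, `δ > 0`). [folklore] -/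
theorem twoPoint_eq_kzero {δ : ℝ} (hδ : 0 < δ) (x : Fin 2 → EuclideanSpace ℝ (Fin 3)) :
    criticalCorr 3 2 (fun j => latticeApprox δ (x j)) / criticalCorr 3 2 ![(0 : Site 3), Pi.single (0 : Fin 3) (⌊1 / δ⌋ : ℤ)] =
      (fun (δ : ℝ) (u : EuclideanSpace ℝ (Fin 3)) => criticalCorr 3 2 ![0, latticeApprox δ u] / criticalCorr 3 2 ![(0 : Site 3), Pi.single (0 : Fin 3) (⌊1 / δ⌋ : ℤ)]) δ (x 1 - x 0 + δ • (WithLp.toLp 2 fun j => Int.fract (x 0 j / δ) : EuclideanSpace ℝ (Fin 3))) := by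
  have hL : latticeApprox δ (x 1 - x 0 + δ • (WithLp.toLp 2 fun j => Int.fract (x 0 j / δ) : EuclideanSpace ℝ (Fin 3))) =
      latticeApprox δ (x 1) - latticeApprox δ (x 0) := by
    funext j
    simp only [latticeApprox_apply, PiLp.add_apply, PiLp.sub_apply, PiLp.smul_apply, smul_eq_mul, Pi.sub_apply]
    have h1 : (x 1 j - x 0 j + δ * Int.fract (x 0 j / δ)) / δ = x 1 j / δ - ((⌊x 0 j / δ⌋ : ℤ) : ℝ) := by
      rw [Int.fract]
      field_simp
      ring
    rw [h1, Int.floor_sub_intCast]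
  have h2 : (fun j => latticeApprox δ (x j)) = ![latticeApprox δ (x 0), latticeApprox δ (x 1)] := by
    funext j; fin_cases j <;> rfl
  show _ = criticalCorr 3 2 ![0, latticeApprox δ _] / _
  rw [hL, h2, ← criticalCorr_two_shift (latticeApprox δ (x 0)) (latticeApprox δ (x 1) - latticeApprox δ (x 0)),
    sub_add_cancel]

/-- The perturbation `δ·fract(x₀/δ)` is uniformly small. [folklore] -/
theorem dist_twoPoint_arg_lt {δ : ℝ} (hδ : 0 < δ) (x : Fin 2 → EuclideanSpace ℝ (Fin 3)) :
    dist (x 1 - x 0 + δ • (WithLp.toLp 2 fun j => Int.fract (x 0 j / δ) : EuclideanSpace ℝ (Fin 3))) (x 1 - x 0) < 2 * δ := by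
  rw [dist_eq_norm, add_sub_cancel_left, norm_smul, Real.norm_eq_abs, abs_of_pos hδ, mul_comm]
  refine mul_lt_mul_of_pos_right ?_ hδ
  rw [EuclideanSpace.norm_eq]
  have hle : ∑ j : Fin 3, ‖(WithLp.toLp 2 fun j => Int.fract (x 0 j / δ) : EuclideanSpace ℝ (Fin 3)) j‖ ^ 2 ≤ 3 := by
    have hk : ∀ j : Fin 3, ‖(WithLp.toLp 2 fun j => Int.fract (x 0 j / δ) : EuclideanSpace ℝ (Fin 3)) j‖ ^ 2 ≤ 1 := by
      intro j
      have h0 := Int.fract_nonneg (x 0 j / δ)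
      have h1 := Int.fract_lt_one (x 0 j / δ)
      show ‖Int.fract (x 0 j / δ)‖ ^ 2 ≤ 1
      rw [Real.norm_eq_abs, abs_of_nonneg h0]
      nlinarith
    calc ∑ j : Fin 3, ‖(WithLp.toLp 2 fun j => Int.fract (x 0 j / δ) : EuclideanSpace ℝ (Fin 3)) j‖ ^ 2
        ≤ ∑ _j : Fin 3, (1 : ℝ) := Finset.sum_le_sum fun j _ => hk j
      _ = 3 := by simp
  calc Real.sqrt (∑ j : Fin 3, ‖(WithLp.toLp 2 fun j => Int.fract (x 0 j / δ) : EuclideanSpace ℝ (Fin 3)) j‖ ^ 2)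
      ≤ Real.sqrt 3 := Real.sqrt_le_sqrt hle
    _ < 2 := by
        rw [show (2 : ℝ) = Real.sqrt 4 by rw [show (4:ℝ) = 2 ^ 2 by norm_num, Real.sqrt_sq (by norm_num)]]
        exact Real.sqrt_lt_sqrt (by norm_num) (by norm_num)

/-- The pinned two-point functional converges to `ψ(x₁ − x₀)` locally uniformly off the diagonal. [folklore] -/
theorem tendsto_twoPoint_psi (h4 : TendstoLocallyUniformlyOn (fun (δ : ℝ) (x : Fin (2 + 2) → EuclideanSpace ℝ (Fin 3)) => criticalCorr 3 (2 + 2) (fun j => latticeApprox δ (x j)) / ∏ j : Fin 2, criticalCorr 3 2 ![latticeApprox δ (x (Fin.castAdd 2 j)), latticeApprox δ (x (Fin.natAdd 2 j))]) q4 (𝓝[>] (0:ℝ)) (NonCoincident 3 (2 + 2)))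
    (hcont : ContinuousOn q4 (NonCoincident 3 (2 + 2))) :
    TendstoLocallyUniformlyOn
      (fun (δ : ℝ) (x : Fin 2 → EuclideanSpace ℝ (Fin 3)) =>
        criticalCorr 3 2 (fun j => latticeApprox δ (x j)) / criticalCorr 3 2 ![(0 : Site 3), Pi.single (0 : Fin 3) (⌊1 / δ⌋ : ℤ)])
      (fun x => limUnder (𝓝[>] (0:ℝ)) (fun δ => (fun (δ : ℝ) (u : EuclideanSpace ℝ (Fin 3)) => criticalCorr 3 2 ![0, latticeApprox δ u] / criticalCorr 3 2 ![(0 : Site 3), Pi.single (0 : Fin 3) (⌊1 / δ⌋ : ℤ)]) δ (x 1 - x 0))) (𝓝[>] (0:ℝ)) (NonCoincident 3 2) := by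
  have hc : Continuous fun x : Fin 2 → EuclideanSpace ℝ (Fin 3) => x 1 - x 0 :=
    (continuous_apply 1).sub (continuous_apply 0)
  have hct : MapsTo (fun x : Fin 2 → EuclideanSpace ℝ (Fin 3) => x 1 - x 0) (NonCoincident 3 2)
      ({0}ᶜ : Set (EuclideanSpace ℝ (Fin 3))) := by
    intro x hx h0
    have h0' : x 1 = x 0 := sub_eq_zero.1 (mem_singleton_iff.1 h0)
    exact absurd ((mem_nonCoincident x).1 hx h0') (by decide)
  have h := tendstoLocallyUniformlyOn_comp_of_approx (Y := Fin 2 → EuclideanSpace ℝ (Fin 3))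
    isOpen_compl_singleton (tendsto_kzero_psi h4 hcont) (continuousOn_psi h4 hcont) (isOpen_nonCoincident 3 2)
    hc.continuousOn hct
    (c' := fun δ x => x 1 - x 0 + δ • (WithLp.toLp 2 fun j => Int.fract (x 0 j / δ) : EuclideanSpace ℝ (Fin 3))) ?_
  · refine (TendstoLocallyUniformlyOn.congr_eventually h ?_)
    filter_upwards [self_mem_nhdsWithin] with δ hδ x _
    exact (twoPoint_eq_kzero hδ x).symm
  · intro ε hε
    have hε2 : 0 < ε / 2 := by positivity
    filter_upwards [Ioo_mem_nhdsGT hε2] with δ hδ x _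
    have := dist_twoPoint_arg_lt hδ.1 x
    linarith [hδ.2]

/-! ### Homogeneity of `ψ` -/

/-- `ψ(c u)/ψ(u)` does not depend on `u ≠ 0`: it is the limit of `⟨σ₀σ_{⌊c/δ⌋e₀}⟩/⟨σ₀σ_{⌊1/δ⌋e₀}⟩`. [folklore] -/
theorem tendsto_pin_ratio (h4 : TendstoLocallyUniformlyOn (fun (δ : ℝ) (x : Fin (2 + 2) → EuclideanSpace ℝ (Fin 3)) => criticalCorr 3 (2 + 2) (fun j => latticeApprox δ (x j)) / ∏ j : Fin 2, criticalCorr 3 2 ![latticeApprox δ (x (Fin.castAdd 2 j)), latticeApprox δ (x (Fin.natAdd 2 j))]) q4 (𝓝[>] (0:ℝ)) (NonCoincident 3 (2 + 2)))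
    (hcont : ContinuousOn q4 (NonCoincident 3 (2 + 2))) {c : ℝ} (hc : 0 < c) {u : EuclideanSpace ℝ (Fin 3)}
    (hu : u ≠ 0) :
    Tendsto (fun δ : ℝ => criticalCorr 3 2 ![(0 : Site 3), Pi.single (0 : Fin 3) (⌊1 / (δ / c)⌋ : ℤ)] /
        criticalCorr 3 2 ![(0 : Site 3), Pi.single (0 : Fin 3) (⌊1 / δ⌋ : ℤ)]) (𝓝[>] (0:ℝ))
      (𝓝 (limUnder (𝓝[>] (0:ℝ)) (fun δ => (fun (δ : ℝ) (u : EuclideanSpace ℝ (Fin 3)) => criticalCorr 3 2 ![0, latticeApprox δ u] / criticalCorr 3 2 ![(0 : Site 3), Pi.single (0 : Fin 3) (⌊1 / δ⌋ : ℤ)]) δ (c • u)) / limUnder (𝓝[>] (0:ℝ)) (fun δ => (fun (δ : ℝ) (u : EuclideanSpace ℝ (Fin 3)) => criticalCorr 3 2 ![0, latticeApprox δ u] / criticalCorr 3 2 ![(0 : Site 3), Pi.single (0 : Fin 3) (⌊1 / δ⌋ : ℤ)]) δ u))) := by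
  have hcu : c • u ≠ 0 := smul_ne_zero hc.ne' hu
  have h1 : Tendsto (fun δ => (fun (δ : ℝ) (u : EuclideanSpace ℝ (Fin 3)) => criticalCorr 3 2 ![0, latticeApprox δ u] / criticalCorr 3 2 ![(0 : Site 3), Pi.single (0 : Fin 3) (⌊1 / δ⌋ : ℤ)]) δ (c • u)) (𝓝[>] (0:ℝ)) (𝓝 (limUnder (𝓝[>] (0:ℝ)) (fun δ => (fun (δ : ℝ) (u : EuclideanSpace ℝ (Fin 3)) => criticalCorr 3 2 ![0, latticeApprox δ u] / criticalCorr 3 2 ![(0 : Site 3), Pi.single (0 : Fin 3) (⌊1 / δ⌋ : ℤ)]) δ (c • u)))) :=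
    (tendsto_kzero_psi h4 hcont).tendsto_at hcu
  have h2 : Tendsto (fun δ => (fun (δ : ℝ) (u : EuclideanSpace ℝ (Fin 3)) => criticalCorr 3 2 ![0, latticeApprox δ u] / criticalCorr 3 2 ![(0 : Site 3), Pi.single (0 : Fin 3) (⌊1 / δ⌋ : ℤ)]) (δ / c) u) (𝓝[>] (0:ℝ)) (𝓝 (limUnder (𝓝[>] (0:ℝ)) (fun δ => (fun (δ : ℝ) (u : EuclideanSpace ℝ (Fin 3)) => criticalCorr 3 2 ![0, latticeApprox δ u] / criticalCorr 3 2 ![(0 : Site 3), Pi.single (0 : Fin 3) (⌊1 / δ⌋ : ℤ)]) δ u))) :=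
    ((tendsto_kzero_psi h4 hcont).tendsto_at hu).comp (tendsto_div_const_nhdsGT hc)
  have h3 := h1.div h2 (psi_pos h4 hcont hu).ne'
  refine h3.congr fun δ => ?_
  have hr1 := criticalCorr_two_pos' (0 : Site 3) (Pi.single (0 : Fin 3) (⌊1 / δ⌋ : ℤ))
  have hr2 := criticalCorr_two_pos' (0 : Site 3) (Pi.single (0 : Fin 3) (⌊1 / (δ / c)⌋ : ℤ))
  have hr3 := criticalCorr_two_pos' (0 : Site 3) (latticeApprox (δ / c) u)
  show (criticalCorr 3 2 ![0, latticeApprox δ (c • u)] / criticalCorr 3 2 ![(0 : Site 3), Pi.single (0 : Fin 3) (⌊1 / δ⌋ : ℤ)]) /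
      (criticalCorr 3 2 ![0, latticeApprox (δ / c) u] / criticalCorr 3 2 ![(0 : Site 3), Pi.single (0 : Fin 3) (⌊1 / (δ / c)⌋ : ℤ)]) =
    criticalCorr 3 2 ![(0 : Site 3), Pi.single (0 : Fin 3) (⌊1 / (δ / c)⌋ : ℤ)] /
      criticalCorr 3 2 ![(0 : Site 3), Pi.single (0 : Fin 3) (⌊1 / δ⌋ : ℤ)]
  rw [Theorems.MoebiusLimitOfTwoPointLaw.Negative.latticeApprox_smul, div_div_div_comm, div_self hr3.ne', one_div_div]

/-- **Homogeneity**: `ψ(c u) = Λ(c) ψ(u)` with `Λ(c) = ψ(c e₀)/ψ(e₀)`. [folklore] -/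
theorem psi_smul (h4 : TendstoLocallyUniformlyOn (fun (δ : ℝ) (x : Fin (2 + 2) → EuclideanSpace ℝ (Fin 3)) => criticalCorr 3 (2 + 2) (fun j => latticeApprox δ (x j)) / ∏ j : Fin 2, criticalCorr 3 2 ![latticeApprox δ (x (Fin.castAdd 2 j)), latticeApprox δ (x (Fin.natAdd 2 j))]) q4 (𝓝[>] (0:ℝ)) (NonCoincident 3 (2 + 2)))
    (hcont : ContinuousOn q4 (NonCoincident 3 (2 + 2))) {c : ℝ} (hc : 0 < c) {u : EuclideanSpace ℝ (Fin 3)}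
    (hu : u ≠ 0) :
    limUnder (𝓝[>] (0:ℝ)) (fun δ => (fun (δ : ℝ) (u : EuclideanSpace ℝ (Fin 3)) => criticalCorr 3 2 ![0, latticeApprox δ u] / criticalCorr 3 2 ![(0 : Site 3), Pi.single (0 : Fin 3) (⌊1 / δ⌋ : ℤ)]) δ (c • u)) =
      (limUnder (𝓝[>] (0:ℝ)) (fun δ => (fun (δ : ℝ) (u : EuclideanSpace ℝ (Fin 3)) => criticalCorr 3 2 ![0, latticeApprox δ u] / criticalCorr 3 2 ![(0 : Site 3), Pi.single (0 : Fin 3) (⌊1 / δ⌋ : ℤ)]) δ (c • (fun (i : Fin 3) => siteVec (Pi.single i (1:ℤ) : Site 3)) 0)) / limUnder (𝓝[>] (0:ℝ)) (fun δ => (fun (δ : ℝ) (u : EuclideanSpace ℝ (Fin 3)) => criticalCorr 3 2 ![0, latticeApprox δ u] / criticalCorr 3 2 ![(0 : Site 3), Pi.single (0 : Fin 3) (⌊1 / δ⌋ : ℤ)]) δ ((fun (i : Fin 3) => siteVec (Pi.single i (1:ℤ) : Site 3)) 0))) *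
        limUnder (𝓝[>] (0:ℝ)) (fun δ => (fun (δ : ℝ) (u : EuclideanSpace ℝ (Fin 3)) => criticalCorr 3 2 ![0, latticeApprox δ u] / criticalCorr 3 2 ![(0 : Site 3), Pi.single (0 : Fin 3) (⌊1 / δ⌋ : ℤ)]) δ u) := by
  have h := tendsto_nhds_unique (tendsto_pin_ratio h4 hcont hc hu) (tendsto_pin_ratio h4 hcont hc (siteVec_single_ne_zero 0))
  rw [← h, div_mul_cancel₀ _ (psi_pos h4 hcont hu).ne']

/-- **Stub `stub_twoPointOfRatioLimit` (the pinned TWO-POINT limit from the 4-point ratio limit).** If the 4-point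
pairing ratio converges locally uniformly to a continuous, translation-invariant `q4`, then for some `Δ` and some
continuous positive `ψ` on `ℝ³ ∖ {0}`, homogeneous of degree `−2Δ`, the pinned two-point function
`⟨σ_{[x/δ]}σ_{[y/δ]}⟩ / ⟨σ₀σ_{⌊1/δ⌋e₀}⟩` converges to `ψ(y − x)` locally uniformly off the diagonal.  (Translation
invariance of `q4` is not even used: the auxiliary configurations are based at `0`.) [folklore] -/
theorem stub_twoPointOfRatioLimit :
    ∀ (q4 : (Fin (2 + 2) → EuclideanSpace ℝ (Fin 3)) → ℝ), TendstoLocallyUniformlyOn (fun (δ : ℝ) (x : Fin (2 + 2) → EuclideanSpace ℝ (Fin 3)) => Literature.Probability.LatticeModels.criticalCorr 3 (2 + 2) (fun i => Literature.Probability.LatticeModels.latticeApprox δ (x i)) / ∏ j : Fin 2, Literature.Probability.LatticeModels.criticalCorr 3 2 ![Literature.Probability.LatticeModels.latticeApprox δ (x (Fin.castAdd 2 j)), Literature.Probability.LatticeModels.latticeApprox δ (x (Fin.natAdd 2 j))]) q4 (nhdsWithin 0 (Set.Ioi 0)) (Literature.Probability.LatticeModels.NonCoincident 3 (2 + 2))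 → ContinuousOn q4 (Literature.Probability.LatticeModels.NonCoincident 3 (2 + 2)) → (∀ (v : EuclideanSpace ℝ (Fin 3)), ∀ x ∈ Literature.Probability.LatticeModels.NonCoincident 3 (2 + 2), q4 (fun i => x i + v) = q4 x) → ∃ (Δ : ℝ) (ψ : EuclideanSpace ℝ (Fin 3) → ℝ), ContinuousOn ψ {0}ᶜ ∧ (∀ u : EuclideanSpace ℝ (Fin 3), u ≠ 0 → 0 < ψ u) ∧ (∀ c : ℝ, 0 < c → ∀ u : EuclideanSpace ℝ (Fin 3), u ≠ 0 → ψ (c • u) = c ^ (-(2 * Δ)) * ψ u) ∧ TendstoLocallyUniformlyOn (fun (δ : ℝ) (x : Fin 2 → EuclideanSpace ℝ (Fin 3)) => Literature.Probability.LatticeModels.criticalCorr 3 2 (fun i => Literature.Probability.LatticeModels.latticeApprox δ (x i)) / Literature.Probability.LatticeModels.criticalCorr 3 2 ![(0 : Literature.Probability.LatticeModels.Site 3), Pi.single (0 : Fin 3) (⌊1 / δ⌋ : ℤ)]) (fun x => ψ (x 1 - x 0)) (nhdsWithin 0 (Set.Ioi 0)) (Literature.Probability.LatticeModels.NonCoincident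 3 2) := by
  intro q4 h4 hcont _
  -- the exponent: `Λ(c) = ψ(c e₀)/ψ(e₀)` is a continuous multiplicative function of `c > 0`
  set ψ : EuclideanSpace ℝ (Fin 3) → ℝ := fun u => limUnder (𝓝[>] (0:ℝ)) (fun δ => (fun (δ : ℝ) (u : EuclideanSpace ℝ (Fin 3)) => criticalCorr 3 2 ![0, latticeApprox δ u] / criticalCorr 3 2 ![(0 : Site 3), Pi.single (0 : Fin 3) (⌊1 / δ⌋ : ℤ)]) δ u) with hψ
  set Λ : ℝ → ℝ := fun c => ψ (c • (fun (i : Fin 3) => siteVec (Pi.single i (1:ℤ) : Site 3)) 0) / ψ ((fun (i : Fin 3) => siteVec (Pi.single i (1:ℤ) : Site 3)) 0) with hΛ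
  have he0 : ((fun (i : Fin 3) => siteVec (Pi.single i (1:ℤ) : Site 3)) 0 : EuclideanSpace ℝ (Fin 3)) ≠ 0 := siteVec_single_ne_zero 0
  have hψpos : ∀ u : EuclideanSpace ℝ (Fin 3), u ≠ 0 → 0 < ψ u := fun u hu => psi_pos h4 hcont hu
  have hψsmul : ∀ c : ℝ, 0 < c → ∀ u : EuclideanSpace ℝ (Fin 3), u ≠ 0 → ψ (c • u) = Λ c * ψ u :=
    fun c hc u hu => psi_smul h4 hcont hc hu
  have hΛpos : ∀ c, 0 < c → 0 < Λ c := fun c hc =>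
    div_pos (hψpos _ (smul_ne_zero hc.ne' he0)) (hψpos _ he0)
  have hΛmul : ∀ c c', 0 < c → 0 < c' → Λ (c * c') = Λ c * Λ c' := by
    intro c c' hc hc'
    have h1 : ψ ((c * c') • (fun (i : Fin 3) => siteVec (Pi.single i (1:ℤ) : Site 3)) 0) = Λ c * (Λ c' * ψ ((fun (i : Fin 3) => siteVec (Pi.single i (1:ℤ) : Site 3)) 0)) := by
      rw [mul_smul, hψsmul c hc _ (smul_ne_zero hc'.ne' he0), hψsmul c' hc' _ he0]
    have h2 : ψ ((c * c') • (fun (i : Fin 3) => siteVec (Pi.single i (1:ℤ) : Site 3)) 0) = Λ (c * c') * ψ ((fun (i : Fin 3) => siteVec (Pi.single i (1:ℤ) : Site 3)) 0) := hψsmul _ (mul_pos hc hc') _ he0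
    have h3 := (hψpos _ he0).ne'
    rw [h2] at h1
    exact mul_right_cancel₀ h3 (h1.trans (mul_assoc _ _ _).symm)
  have hΛcont : ContinuousOn Λ (Ioi 0) := by
    refine ContinuousOn.div ?_ continuousOn_const fun c _ => (hψpos _ he0).ne'
    refine (continuousOn_psi h4 hcont).comp (continuous_id.smul continuous_const).continuousOn ?_
    intro c hc
    exact smul_ne_zero (ne_of_gt hc) he0
  obtain ⟨a, ha⟩ := exists_rpow_of_mul_of_continuousOn hΛpos hΛcont hΛmul
  refine ⟨-a / 2, ψ, continuousOn_psi h4 hcont, hψpos, ?_, tendsto_twoPoint_psi h4 hcont⟩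
  intro c hc u hu
  rw [hψsmul c hc u hu, ha c hc]
  congr 1
  ring

end TwoPoint


end Summit.CriticalPhenomena.Ising3DConformalLimit.Cruxes.SpinRatioMoebius.Birth

end
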